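import Summits.ValiantsHypothesis.ValiantsHypothesis.Theorems.PolyaContinuedSignedCoverLittleTransfer
import HarnessLib

/-!
# Route PolyaContinued — support item `SignedCoverLittle` (stmt-ValiantsHypothesis-7426):
# H-side transfer, part 2 — the dicircuits of `D(H)` (step (F1) of `proof-LabelTransfer.md`)

Sequel to `PolyaContinuedSignedCoverLittleTransfer.lean` (label-bijection transfer lemmas). NORMAL
FORM: `φ (i, i) = (i, i)` and the diagonal (identity matching) lies inside `H`; the digraph
`D(H)` has an arc `i → j` for every off-diagonal cell, and its dicircuits are the cyclic
permutations inside `H` (`PfaffianDicycles.lean`). If on the `E`-side every non-identity perfect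
matching is a single dicircuit and any two of them share a moved point (the targets
`E₁ = S ∪ μ` of the proof), then:

* `image_ne_one`, `isCycle_of_ne_one` (F1a), `exists_image_isCycle` — every non-identity
  perfect matching `σ` of `H` is a single dicircuit `γ_δ`, the lift of the dicircuit `δ` of
  `D(E)` it is labelled by, with `supp δ ⊆ supp γ_δ`;
* `exists_common_moved` (F1d) — any two dicircuits of `D(H)` share a moved point (two disjoint
  ones would be a seventh perfect matching);
* (F1f) essential cells — the subgraph of cells of `H` lying on perfect matchings has the same
  perfect matchings (`isPerfectMatching_iff_essential`), inherits the label identity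
  (`labelIdentity_essential`) and the diagonal (`diag_mem_essential`), and each of its
  off-diagonal cells is an arc of a dicircuit (`exists_isCycle_through_of_mem_essential`):
  "`D(H)` is the union of its dicircuits".

With `card_filter_isPerfectMatching_eq` (part 1) the dicircuits of `D(H)` are thus exactly the
`|PM(E)| - 1` lifts `γ_δ`. All statements over `ℂ` and `Fin n`; no new definitions.
-/

noncomputable section

namespace Summit.ValiantsHypothesis.PolyaContinued

open MvPolynomial Finset Literature.Combinatorics.SimpleGraph Equiv

variable {n : ℕ}

/-! ### (F1) Normal form: dicircuits of `D(H)` -/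

/-- In normal form (`φ (i, i) = (i, i)`) the label exponent of the identity matching is the matching
exponent of the identity: the diagonal of `H` is labelled by the diagonal of `E`. [folklore] -/
theorem labelExponent_one {φ : Fin n × Fin n → Fin n × Fin n} (hφ : ∀ i, φ (i, i) = (i, i)) :
    (∑ i, Finsupp.single (φ (i, (1 : Perm (Fin n)) i)) 1 : (Fin n × Fin n) →₀ ℕ) =
      matchingExponent (1 : Perm (Fin n)) := by
  unfold matchingExponent
  exact Finset.sum_congr rfl fun i _ => by rw [Perm.one_apply, hφ]

/-- In normal form with the diagonal inside `H`, the image of a non-identity perfect matching of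
`H` is a non-identity perfect matching of `E`. [folklore] -/
theorem image_ne_one {H E : Finset (Fin n × Fin n)} {φ : Fin n × Fin n → Fin n × Fin n}
    (hid : (∑ σ : Equiv.Perm (Fin n), if (∀ i, (i, σ i) ∈ H) then
        ∏ i, (X (φ (i, σ i)) : MvPolynomial (Fin n × Fin n) ℂ) else 0) =
      perfectMatchingPoly E ℂ)
    (hφ : ∀ i, φ (i, i) = (i, i)) (hHd : ∀ i, (i, i) ∈ H) {σ π : Perm (Fin n)}
    (hσ : ∀ i, (i, σ i) ∈ H) (hne : σ ≠ 1)
    (h : (∑ i, Finsupp.single (φ (i, σ i)) 1 : (Fin n × Fin n) →₀ ℕ) = matchingExponent π) :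
    π ≠ 1 := by
  rintro rfl
  have h1 : ∀ i, (i, (1 : Perm (Fin n)) i) ∈ H := fun i => by simpa using hHd i
  exact hne (labelExponent_injective_of_labelIdentity hid hσ h1
    (h.trans (labelExponent_one hφ).symm))

/-- **(F1a) Every non-identity perfect matching of `H` is a single dicircuit**, provided the same
holds in `E` (normal form, diagonal inside `H`): the image `π ≠ 1` is a cycle, i.e. `1⁻¹ π` is,
and adjacency pulls back (`isCycle_inv_mul_of_labelIdentity` with the identity matchings).
[folklore] -/
theorem isCycle_of_ne_one {H E : Finset (Fin n × Fin n)} {φ : Fin n × Fin n → Fin n × Fin n}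
    (hid : (∑ σ : Equiv.Perm (Fin n), if (∀ i, (i, σ i) ∈ H) then
        ∏ i, (X (φ (i, σ i)) : MvPolynomial (Fin n × Fin n) ℂ) else 0) =
      perfectMatchingPoly E ℂ)
    (hφ : ∀ i, φ (i, i) = (i, i)) (hHd : ∀ i, (i, i) ∈ H)
    (hE : ∀ π : Perm (Fin n), (∀ i, (i, π i) ∈ E) → π ≠ 1 → π.IsCycle)
    {σ : Perm (Fin n)} (hσ : ∀ i, (i, σ i) ∈ H) (hne : σ ≠ 1) : σ.IsCycle := by
  have h1 : ∀ i, (i, (1 : Perm (Fin n)) i) ∈ H := fun i => by simpa using hHd i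
  obtain ⟨π, hπE, hπ⟩ := exists_perm_of_labelIdentity hid hσ
  have hπ1 : π ≠ 1 := image_ne_one hid hφ hHd hσ hne hπ
  have hcyc : ((1 : Perm (Fin n))⁻¹ * π).IsCycle := by simpa using hE π hπE hπ1
  simpa using isCycle_inv_mul_of_labelIdentity hid h1 hσ (labelExponent_one hφ) hπ hcyc

/-- The image of a non-identity perfect matching of `H`, with everything the later steps use: it is
a non-identity dicircuit of `E`, labelled by `σ`, and its support is contained in that of `σ`
(normal form, diagonal inside `H`, non-identity matchings of `E` are dicircuits). [folklore] -/
theorem exists_image_isCycle {H E : Finset (Fin n × Fin n)} {φ : Fin n × Fin n → Fin n × Fin n}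
    (hid : (∑ σ : Equiv.Perm (Fin n), if (∀ i, (i, σ i) ∈ H) then
        ∏ i, (X (φ (i, σ i)) : MvPolynomial (Fin n × Fin n) ℂ) else 0) =
      perfectMatchingPoly E ℂ)
    (hφ : ∀ i, φ (i, i) = (i, i)) (hHd : ∀ i, (i, i) ∈ H)
    (hE : ∀ π : Perm (Fin n), (∀ i, (i, π i) ∈ E) → π ≠ 1 → π.IsCycle)
    {σ : Perm (Fin n)} (hσ : ∀ i, (i, σ i) ∈ H) (hne : σ ≠ 1) :
    ∃ π : Perm (Fin n), (∀ i, (i, π i) ∈ E) ∧ π ≠ 1 ∧ π.IsCycle ∧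
      (∑ i, Finsupp.single (φ (i, σ i)) 1 : (Fin n × Fin n) →₀ ℕ) = matchingExponent π ∧
      π.support ⊆ σ.support := by
  obtain ⟨π, hπE, hπ⟩ := exists_perm_of_labelIdentity hid hσ
  have hπ1 : π ≠ 1 := image_ne_one hid hφ hHd hσ hne hπ
  exact ⟨π, hπE, hπ1, hE π hπE hπ1, hπ, support_subset_of_labelExponent_eq hφ hπ⟩

/-- **(F1d) Any two dicircuits of `D(H)` share a moved point**, provided any two non-identity
perfect matchings of `E` do (normal form, diagonal inside `H`): a common moved point of the
images is a common moved point (`apply_eq_self_of_labelExponent_eq`). In particular `D(H)` has no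
two disjoint dicircuits (they would give a seventh perfect matching). [folklore] -/
theorem exists_common_moved {H E : Finset (Fin n × Fin n)} {φ : Fin n × Fin n → Fin n × Fin n}
    (hid : (∑ σ : Equiv.Perm (Fin n), if (∀ i, (i, σ i) ∈ H) then
        ∏ i, (X (φ (i, σ i)) : MvPolynomial (Fin n × Fin n) ℂ) else 0) =
      perfectMatchingPoly E ℂ)
    (hφ : ∀ i, φ (i, i) = (i, i)) (hHd : ∀ i, (i, i) ∈ H)
    (hEint : ∀ π π' : Perm (Fin n), (∀ i, (i, π i) ∈ E) → (∀ i, (i, π' i) ∈ E) → π ≠ 1 →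
      π' ≠ 1 → ∃ a, π a ≠ a ∧ π' a ≠ a)
    {σ σ' : Perm (Fin n)} (hσ : ∀ i, (i, σ i) ∈ H) (hσ' : ∀ i, (i, σ' i) ∈ H) (hne : σ ≠ 1)
    (hne' : σ' ≠ 1) : ∃ x, σ x ≠ x ∧ σ' x ≠ x := by
  obtain ⟨π, hπE, hπ⟩ := exists_perm_of_labelIdentity hid hσ
  obtain ⟨π', hπ'E, hπ'⟩ := exists_perm_of_labelIdentity hid hσ'
  obtain ⟨a, ha, ha'⟩ := hEint π π' hπE hπ'E (image_ne_one hid hφ hHd hσ hne hπ)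
    (image_ne_one hid hφ hHd hσ' hne' hπ')
  exact ⟨a, fun e => ha (apply_eq_self_of_labelExponent_eq hφ hπ e),
    fun e => ha' (apply_eq_self_of_labelExponent_eq hφ hπ' e)⟩

/-! ### (F1f) Essential cells: `D(H)` is the union of its dicircuits -/

/-- The ESSENTIAL cells of `H` — those lying on some perfect matching — form a subgraph of `H`.
[folklore] -/
theorem essential_subset (H : Finset (Fin n × Fin n)) :
    (H.filter fun c => ∃ σ : Perm (Fin n), (∀ i, (i, σ i) ∈ H) ∧ σ c.1 = c.2) ⊆ H :=
  Finset.filter_subset _ _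

/-- A perfect matching of `H` is a perfect matching of the subgraph of essential cells, and
conversely. [folklore] -/
theorem isPerfectMatching_iff_essential (H : Finset (Fin n × Fin n)) (σ : Perm (Fin n)) :
    (∀ i, (i, σ i) ∈ H) ↔
      ∀ i, (i, σ i) ∈ H.filter fun c => ∃ τ : Perm (Fin n), (∀ i, (i, τ i) ∈ H) ∧ τ c.1 = c.2 :=
  ⟨fun h i => Finset.mem_filter.2 ⟨h i, σ, h, rfl⟩, fun h i => (Finset.mem_filter.1 (h i)).1⟩

/-- The label identity restricts to the subgraph of essential cells (same perfect matchings, same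
label polynomial). [folklore] -/
theorem labelIdentity_essential {H E : Finset (Fin n × Fin n)} {φ : Fin n × Fin n → Fin n × Fin n}
    (hid : (∑ σ : Equiv.Perm (Fin n), if (∀ i, (i, σ i) ∈ H) then
        ∏ i, (X (φ (i, σ i)) : MvPolynomial (Fin n × Fin n) ℂ) else 0) =
      perfectMatchingPoly E ℂ) :
    (∑ σ : Equiv.Perm (Fin n), if (∀ i, (i, σ i) ∈ H.filter fun c =>
        ∃ τ : Perm (Fin n), (∀ i, (i, τ i) ∈ H) ∧ τ c.1 = c.2) then
        ∏ i, (X (φ (i, σ i)) : MvPolynomial (Fin n × Fin n) ℂ) else 0) =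
      perfectMatchingPoly E ℂ := by
  classical
  rw [← hid]
  refine Finset.sum_congr rfl fun σ _ => ?_
  by_cases hσ : ∀ i, (i, σ i) ∈ H
  · rw [if_pos hσ, if_pos ((isPerfectMatching_iff_essential H σ).1 hσ)]
  · rw [if_neg hσ, if_neg fun h => hσ ((isPerfectMatching_iff_essential H σ).2 h)]

/-- Every essential cell lies on a perfect matching of the subgraph of essential cells. [folklore] -/
theorem exists_isPerfectMatching_through_of_mem_essential {H : Finset (Fin n × Fin n)}
    {c : Fin n × Fin n}
    (hc : c ∈ H.filter fun c => ∃ τ : Perm (Fin n), (∀ i, (i, τ i) ∈ H) ∧ τ c.1 = c.2) :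
    ∃ σ : Perm (Fin n), (∀ i, (i, σ i) ∈ H.filter fun c =>
      ∃ τ : Perm (Fin n), (∀ i, (i, τ i) ∈ H) ∧ τ c.1 = c.2) ∧ σ c.1 = c.2 := by
  obtain ⟨-, σ, hσ, hσc⟩ := Finset.mem_filter.1 hc
  exact ⟨σ, (isPerfectMatching_iff_essential H σ).1 hσ, hσc⟩

/-- If the diagonal lies inside `H`, it lies inside the subgraph of essential cells (the identity
matching). [folklore] -/
theorem diag_mem_essential {H : Finset (Fin n × Fin n)} (hHd : ∀ i, (i, i) ∈ H) (i : Fin n) :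
    (i, i) ∈ H.filter fun c => ∃ τ : Perm (Fin n), (∀ i, (i, τ i) ∈ H) ∧ τ c.1 = c.2 :=
  Finset.mem_filter.2 ⟨hHd i, 1, fun j => by simpa using hHd j, rfl⟩

/-- **`D(H)` is the union of its dicircuits** (after deleting inessential cells): in normal form
with the diagonal inside `H` and the non-identity perfect matchings of `E` single dicircuits, every
off-diagonal essential cell of `H` is an arc of a dicircuit of the subgraph of essential cells.
[folklore] -/
theorem exists_isCycle_through_of_mem_essential {H E : Finset (Fin n × Fin n)}
    {φ : Fin n × Fin n → Fin n × Fin n}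
    (hid : (∑ σ : Equiv.Perm (Fin n), if (∀ i, (i, σ i) ∈ H) then
        ∏ i, (X (φ (i, σ i)) : MvPolynomial (Fin n × Fin n) ℂ) else 0) =
      perfectMatchingPoly E ℂ)
    (hφ : ∀ i, φ (i, i) = (i, i)) (hHd : ∀ i, (i, i) ∈ H)
    (hE : ∀ π : Perm (Fin n), (∀ i, (i, π i) ∈ E) → π ≠ 1 → π.IsCycle)
    {c : Fin n × Fin n}
    (hc : c ∈ H.filter fun c => ∃ τ : Perm (Fin n), (∀ i, (i, τ i) ∈ H) ∧ τ c.1 = c.2)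
    (hoff : c.1 ≠ c.2) :
    ∃ γ : Perm (Fin n), γ.IsCycle ∧ (∀ i, (i, γ i) ∈ H.filter fun c =>
      ∃ τ : Perm (Fin n), (∀ i, (i, τ i) ∈ H) ∧ τ c.1 = c.2) ∧ γ c.1 = c.2 := by
  obtain ⟨σ, hσ, hσc⟩ := exists_isPerfectMatching_through_of_mem_essential hc
  have hσH : ∀ i, (i, σ i) ∈ H := (isPerfectMatching_iff_essential H σ).2 hσ
  have hne : σ ≠ 1 := by
    rintro rfl
    exact hoff (by simpa using hσc)
  exact ⟨σ, isCycle_of_ne_one hid hφ hHd hE hσH hne, hσ, hσc⟩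

/-! ### (F1g) Pairwise single cycles; closure of the set of perfect matchings -/

/-- **(F1g) Any two perfect matchings of `H` differ by a single alternating circuit**, provided
the same holds in `E`: the images of `σ ≠ σ'` are distinct, and adjacency pulls back
(`isCycle_inv_mul_of_labelIdentity`). No normal form is needed. [folklore] -/
theorem isCycle_inv_mul_of_ne {H E : Finset (Fin n × Fin n)} {φ : Fin n × Fin n → Fin n × Fin n}
    (hid : (∑ σ : Equiv.Perm (Fin n), if (∀ i, (i, σ i) ∈ H) then
        ∏ i, (X (φ (i, σ i)) : MvPolynomial (Fin n × Fin n) ℂ) else 0) =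
      perfectMatchingPoly E ℂ)
    (hEcyc : ∀ π π' : Perm (Fin n), (∀ i, (i, π i) ∈ E) → (∀ i, (i, π' i) ∈ E) → π ≠ π' →
      (π⁻¹ * π').IsCycle)
    {σ σ' : Perm (Fin n)} (hσ : ∀ i, (i, σ i) ∈ H) (hσ' : ∀ i, (i, σ' i) ∈ H) (hne : σ ≠ σ') :
    (σ⁻¹ * σ').IsCycle := by
  obtain ⟨π, hπE, hπ⟩ := exists_perm_of_labelIdentity hid hσ
  obtain ⟨π', hπ'E, hπ'⟩ := exists_perm_of_labelIdentity hid hσ'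
  have hππ' : π ≠ π' := by
    rintro rfl
    exact hne (labelExponent_injective_of_labelIdentity hid hσ hσ' (hπ.trans hπ'.symm))
  exact isCycle_inv_mul_of_labelIdentity hid hσ hσ' hπ hπ' (hEcyc π π' hπE hπ'E hππ')

/-- A permutation moving every point along `μ`, along `ν`, or not at all, where `μ, ν` are perfect
matchings of `H ⊇ diagonal`, is a perfect matching of `H` (all its cells are cells of `μ`, of
`ν`, or diagonal). In particular every splice of two dicircuits of `D(H)` is a perfect matching,
hence one of the `|PM(E)| - 1` dicircuits. [folklore] -/
theorem isPerfectMatching_of_forall_apply_mem {H : Finset (Fin n × Fin n)}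
    (hHd : ∀ i, (i, i) ∈ H) {μ ν c : Perm (Fin n)} (hμ : ∀ i, (i, μ i) ∈ H)
    (hν : ∀ i, (i, ν i) ∈ H) (hc : ∀ v, c v = μ v ∨ c v = ν v ∨ c v = v) (i : Fin n) :
    (i, c i) ∈ H := by
  rcases hc i with h | h | h <;> rw [h]
  exacts [hμ i, hν i, hHd i]

/-- Counting the dicircuits: with the diagonal inside `H`, the non-identity perfect matchings of
`H` are all perfect matchings but one. [folklore] -/
theorem card_filter_isPerfectMatching_ne_one {H : Finset (Fin n × Fin n)}
    (hHd : ∀ i, (i, i) ∈ H) :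
    (Finset.univ.filter fun σ : Perm (Fin n) => (∀ i, (i, σ i) ∈ H) ∧ σ ≠ 1).card + 1 =
      (Finset.univ.filter fun σ : Perm (Fin n) => ∀ i, (i, σ i) ∈ H).card := by
  classical
  have h1 : (1 : Perm (Fin n)) ∈ Finset.univ.filter fun σ : Perm (Fin n) => ∀ i, (i, σ i) ∈ H :=
    Finset.mem_filter.2 ⟨Finset.mem_univ _, fun i => by simpa using hHd i⟩
  have heq : (Finset.univ.filter fun σ : Perm (Fin n) => (∀ i, (i, σ i) ∈ H) ∧ σ ≠ 1) =
      (Finset.univ.filter fun σ : Perm (Fin n) => ∀ i, (i, σ i) ∈ H).erase 1 := by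
    ext σ
    simp only [Finset.mem_filter, Finset.mem_univ, true_and, Finset.mem_erase]
    tauto
  rw [heq, Finset.card_erase_add_one h1]

end Summit.ValiantsHypothesis.PolyaContinued
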